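import Literature.Probability.Distributions.StdGaussianDensity
import Mathlib.Analysis.InnerProductSpace.PiL2
import HarnessLib

/-!
# Standard Gaussian vectors on complex Euclidean spaces: invariance and orthogonal splitting

`Literature/Probability/Distributions/`. Infrastructure for the standard Gaussian measure
`ProbabilityTheory.stdGaussian V` on a finite-dimensional space carrying compatible complex and
real inner-product structures — the case at hand being `V = EuclideanSpace ℂ ι`, whose real inner
product `Re ⟪·, ·⟫` Mathlib provides coordinatewise (a general complex inner product space has no
canonical real-inner-product *instance*, `InnerProductSpace.complexToReal` being a definition, so
the statements are phrased for spaces carrying both structures with `IsScalarTower ℝ ℂ V`; the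
Gaussian only sees the real one).

* `stdGaussian_map_complexLinearIsometryEquiv` — invariance under complex linear isometries
  (Mathlib's `stdGaussian_map` after restricting scalars, `LinearIsometryEquiv.realOfComplex`);
* `map_euclConcat_prod_stdGaussian` / `map_euclSplit_stdGaussian` — the standard Gaussian of
  `ℂ^{ι₁ ⊕ ι₂}` is the product of those of `ℂ^{ι₁}` and `ℂ^{ι₂}` (characteristic functions:
  `e^{-‖t‖²/2} = e^{-‖t₁‖²/2} e^{-‖t₂‖²/2}`), hence
  `map_euclSplit_repr_stdGaussian`: the blocks of coordinates of a standard Gaussian vector in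
  any complex orthonormal basis indexed by `ι₁ ⊕ ι₂` are independent standard Gaussians;
* `Submodule.sumOrthonormalBasis` — the orthonormal basis of `V` indexed by `ι₁ ⊕ ι₂` assembled
  from orthonormal bases of a subspace `K` and of `Kᗮ` (used to adapt coordinates to `K ⊕ Kᗮ`);
* `stdGaussian_apply_complexSubmodule_eq_zero` — proper complex subspaces are null (the real
  case, from `stdGaussian ≪ Lebesgue`, is in `StdGaussianDensity.lean`).

Relation to the tree's other complex Gaussian vector: `Literature.Probability.RandomMatrix.gaussianEuc ι`
(`ComplexGaussianVector.lean`, built on `stdComplexGaussian`, `E|zᵢ|² = 1`, characteristic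
function `e^{-‖t‖²/4}`) is the image of `stdGaussian (EuclideanSpace ℂ ι)` (variance `1` per real
coordinate, `e^{-‖t‖²/2}`) under `x ↦ x/√2`; the Gram–Schmidt / sphere-marginal constructions
downstream are scale invariant, so either normalisation serves. The auxiliary definitions placed
in Mathlib namespaces (`LinearIsometryEquiv.realOfComplex`, `Submodule.sumOrthonormalBasis` and its
lemmas) are deliberate dot-notation extensions. All [folklore].
-/

noncomputable section

open MeasureTheory ProbabilityTheory Set Module Complex
open scoped ENNReal InnerProductSpace

namespace Literature.Probability.Distributions

/-! ### Invariance under complex linear isometries -/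

section Invariance

variable {V W : Type*} [NormedAddCommGroup V] [InnerProductSpace ℂ V] [InnerProductSpace ℝ V]
  [IsScalarTower ℝ ℂ V] [NormedAddCommGroup W] [InnerProductSpace ℂ W] [InnerProductSpace ℝ W]
  [IsScalarTower ℝ ℂ W]

omit [InnerProductSpace ℂ V] [InnerProductSpace ℂ W] in
/-- A complex linear isometric equivalence as a real one (same map; the norm is shared and
real scalars act through `ℝ → ℂ`). Declared in Mathlib's `LinearIsometryEquiv` namespace for dot
notation (no `restrictScalars` for isometric equivalences at this Mathlib pin). [folklore] -/
def _root_.LinearIsometryEquiv.realOfComplex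
    {V W : Type*} [NormedAddCommGroup V] [NormedAddCommGroup W] [Module ℂ V] [Module ℂ W]
    [Module ℝ V] [Module ℝ W] [IsScalarTower ℝ ℂ V] [IsScalarTower ℝ ℂ W]
    (f : V ≃ₗᵢ[ℂ] W) : V ≃ₗᵢ[ℝ] W :=
  { f.toLinearEquiv.restrictScalars ℝ with norm_map' := f.norm_map }

omit [InnerProductSpace ℂ V] [InnerProductSpace ℂ W] in
/-- `realOfComplex` does not change the underlying map (declared in the `LinearIsometryEquiv`
namespace for dot notation). [folklore] -/
@[simp]
theorem _root_.LinearIsometryEquiv.coe_realOfComplex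
    {V W : Type*} [NormedAddCommGroup V] [NormedAddCommGroup W] [Module ℂ V] [Module ℂ W]
    [Module ℝ V] [Module ℝ W] [IsScalarTower ℝ ℂ V] [IsScalarTower ℝ ℂ W]
    (f : V ≃ₗᵢ[ℂ] W) : ⇑f.realOfComplex = ⇑f :=
  rfl

variable [FiniteDimensional ℝ V] [MeasurableSpace V] [BorelSpace V]
  [MeasurableSpace W] [BorelSpace W]

/-- **Unitary invariance of the standard Gaussian**: a complex linear isometric equivalence maps
`stdGaussian V` to `stdGaussian W` (Mathlib's `stdGaussian_map` for the underlying real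
isometry). [folklore] -/
theorem stdGaussian_map_complexLinearIsometryEquiv (f : V ≃ₗᵢ[ℂ] W) :
    haveI := f.realOfComplex.finiteDimensional
    (stdGaussian V).map f = stdGaussian W := by
  have h := stdGaussian_map f.realOfComplex
  rwa [LinearIsometryEquiv.coe_realOfComplex] at h

end Invariance

/-! ### Splitting the coordinates -/

section Split

variable {ι₁ ι₂ : Type*} [Fintype ι₁] [Fintype ι₂]

/-- Splitting a vector of `ℂ^{ι₁ ⊕ ι₂}` into its two blocks of coordinates: a local name for
Mathlib's `EuclideanSpace.sumEquivProd`. [folklore] -/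
abbrev euclSplit (x : EuclideanSpace ℂ (ι₁ ⊕ ι₂)) : EuclideanSpace ℂ ι₁ × EuclideanSpace ℂ ι₂ :=
  EuclideanSpace.sumEquivProd (𝕜 := ℂ) x

/-- Concatenating two blocks of coordinates into a vector of `ℂ^{ι₁ ⊕ ι₂}`: a local name for the
inverse of Mathlib's `EuclideanSpace.sumEquivProd`. [folklore] -/
abbrev euclConcat (p : EuclideanSpace ℂ ι₁ × EuclideanSpace ℂ ι₂) : EuclideanSpace ℂ (ι₁ ⊕ ι₂) :=
  (EuclideanSpace.sumEquivProd (𝕜 := ℂ) (ι := ι₁) (κ := ι₂)).symm p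

/-- First block of `euclSplit`. [folklore] -/
@[simp] theorem euclSplit_fst_apply (x : EuclideanSpace ℂ (ι₁ ⊕ ι₂)) (i : ι₁) :
    (euclSplit x).1 i = x (Sum.inl i) := rfl

/-- Second block of `euclSplit`. [folklore] -/
@[simp] theorem euclSplit_snd_apply (x : EuclideanSpace ℂ (ι₁ ⊕ ι₂)) (j : ι₂) :
    (euclSplit x).2 j = x (Sum.inr j) := rfl

/-- `inl`-coordinates of `euclConcat`. [folklore] -/
@[simp] theorem euclConcat_apply_inl (p : EuclideanSpace ℂ ι₁ × EuclideanSpace ℂ ι₂) (i : ι₁) :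
    euclConcat p (Sum.inl i) = p.1 i := rfl

/-- `inr`-coordinates of `euclConcat`. [folklore] -/
@[simp] theorem euclConcat_apply_inr (p : EuclideanSpace ℂ ι₁ × EuclideanSpace ℂ ι₂) (j : ι₂) :
    euclConcat p (Sum.inr j) = p.2 j := rfl

/-- The real inner product of `ℂ^{ι₁ ⊕ ι₂}` splits over the two blocks. [folklore] -/
theorem real_inner_euclConcat (p : EuclideanSpace ℂ ι₁ × EuclideanSpace ℂ ι₂)
    (t : EuclideanSpace ℂ (ι₁ ⊕ ι₂)) :
    ⟪euclConcat p, t⟫_ℝ = ⟪p.1, (euclSplit t).1⟫_ℝ + ⟪p.2, (euclSplit t).2⟫_ℝ := by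
  simp only [PiLp.inner_apply, Fintype.sum_sum_type]
  rfl

/-- The squared norm of `ℂ^{ι₁ ⊕ ι₂}` splits over the two blocks. [folklore] -/
theorem norm_sq_eq_euclSplit (t : EuclideanSpace ℂ (ι₁ ⊕ ι₂)) :
    ‖t‖ ^ 2 = ‖(euclSplit t).1‖ ^ 2 + ‖(euclSplit t).2‖ ^ 2 := by
  simp only [EuclideanSpace.norm_sq_eq, Fintype.sum_sum_type]
  rfl

/-- **Independence of the coordinate blocks**: concatenating independent standard Gaussian
vectors of `ℂ^{ι₁}` and `ℂ^{ι₂}` gives a standard Gaussian vector of `ℂ^{ι₁ ⊕ ι₂}` (the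
characteristic functions agree: `e^{-‖t‖²/2} = e^{-‖t₁‖²/2} e^{-‖t₂‖²/2}`). [folklore] -/
theorem map_euclConcat_prod_stdGaussian :
    ((stdGaussian (EuclideanSpace ℂ ι₁)).prod (stdGaussian (EuclideanSpace ℂ ι₂))).map euclConcat =
      stdGaussian (EuclideanSpace ℂ (ι₁ ⊕ ι₂)) := by
  refine Measure.ext_of_charFun (funext fun t => ?_)
  rw [charFun_apply, charFun_stdGaussian, integral_map (EuclideanSpace.sumEquivProd (𝕜 := ℂ) (ι := ι₁) (κ := ι₂)).symm.continuous.measurable.aemeasurable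
    (by fun_prop)]
  have h : ∀ p : EuclideanSpace ℂ ι₁ × EuclideanSpace ℂ ι₂,
      cexp ((⟪euclConcat p, t⟫_ℝ : ℂ) * I) =
        cexp ((⟪p.1, (euclSplit t).1⟫_ℝ : ℂ) * I) * cexp ((⟪p.2, (euclSplit t).2⟫_ℝ : ℂ) * I) := by
    intro p
    rw [real_inner_euclConcat, ← Complex.exp_add]
    push_cast
    ring_nf
  simp_rw [h]
  rw [integral_prod_mul (fun a : EuclideanSpace ℂ ι₁ => cexp ((⟪a, (euclSplit t).1⟫_ℝ : ℂ) * I))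
    (fun b : EuclideanSpace ℂ ι₂ => cexp ((⟪b, (euclSplit t).2⟫_ℝ : ℂ) * I)),
    ← charFun_apply, ← charFun_apply, charFun_stdGaussian, charFun_stdGaussian, ← Complex.exp_add]
  congr 1
  have h3 : ((‖t‖ : ℂ)) ^ 2 = ((‖(euclSplit t).1‖ : ℂ)) ^ 2 + ((‖(euclSplit t).2‖ : ℂ)) ^ 2 := by
    exact_mod_cast norm_sq_eq_euclSplit t
  rw [h3]
  ring

/-- **Independence of the coordinate blocks**, split form: the two blocks of coordinates of a
standard Gaussian vector of `ℂ^{ι₁ ⊕ ι₂}` are independent standard Gaussian vectors. [folklore] -/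
theorem map_euclSplit_stdGaussian :
    (stdGaussian (EuclideanSpace ℂ (ι₁ ⊕ ι₂))).map euclSplit =
      (stdGaussian (EuclideanSpace ℂ ι₁)).prod (stdGaussian (EuclideanSpace ℂ ι₂)) := by
  rw [← map_euclConcat_prod_stdGaussian,
    Measure.map_map (EuclideanSpace.sumEquivProd (𝕜 := ℂ) (ι := ι₁) (κ := ι₂)).continuous.measurable
      (EuclideanSpace.sumEquivProd (𝕜 := ℂ) (ι := ι₁) (κ := ι₂)).symm.continuous.measurable]
  have : euclSplit ∘ euclConcat = (id : EuclideanSpace ℂ ι₁ × EuclideanSpace ℂ ι₂ → _) :=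
    funext (EuclideanSpace.sumEquivProd (𝕜 := ℂ) (ι := ι₁) (κ := ι₂)).apply_symm_apply
  rw [this, Measure.map_id]

variable {V : Type*} [NormedAddCommGroup V] [InnerProductSpace ℂ V] [InnerProductSpace ℝ V]
  [IsScalarTower ℝ ℂ V] [FiniteDimensional ℝ V] [MeasurableSpace V] [BorelSpace V]

/-- **Coordinates of a standard Gaussian vector in an orthonormal basis.** For a complex
orthonormal basis `b` of `V` indexed by `ι₁ ⊕ ι₂`, the two blocks `(⟪b (inl i), g⟫)ᵢ` and
`(⟪b (inr j), g⟫)ⱼ` of coordinates of `g ∼ stdGaussian V` are independent standard Gaussian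
vectors of `ℂ^{ι₁}` and `ℂ^{ι₂}`. [folklore] -/
theorem map_euclSplit_repr_stdGaussian (b : OrthonormalBasis (ι₁ ⊕ ι₂) ℂ V) :
    (stdGaussian V).map (fun g => euclSplit (b.repr g)) =
      (stdGaussian (EuclideanSpace ℂ ι₁)).prod (stdGaussian (EuclideanSpace ℂ ι₂)) := by
  rw [← map_euclSplit_stdGaussian, ← stdGaussian_map_complexLinearIsometryEquiv b.repr,
    Measure.map_map (EuclideanSpace.sumEquivProd (𝕜 := ℂ) (ι := ι₁) (κ := ι₂)).continuous.measurable
      b.repr.continuous.measurable]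
  rfl

end Split

/-! ### Orthonormal bases adapted to `K ⊕ Kᗮ` -/

section SumBasis

variable {𝕜 : Type*} [RCLike 𝕜] {V : Type*} [NormedAddCommGroup V] [InnerProductSpace 𝕜 V]
  {ι₁ ι₂ : Type*} [Fintype ι₁] [Fintype ι₂]

/-- The family obtained by juxtaposing orthonormal bases of `K` and of `Kᗮ` is orthonormal
(declared in Mathlib's `Submodule` namespace for dot notation). [folklore] -/
theorem _root_.Submodule.orthonormal_sum_elim (K : Submodule 𝕜 V) (b₁ : OrthonormalBasis ι₁ 𝕜 K)
    (b₂ : OrthonormalBasis ι₂ 𝕜 Kᗮ) :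
    Orthonormal 𝕜 (Sum.elim (fun i => (b₁ i : V)) (fun j => (b₂ j : V))) := by
  classical
  rw [orthonormal_iff_ite]
  have h₁ := orthonormal_iff_ite.1 b₁.orthonormal
  have h₂ := orthonormal_iff_ite.1 b₂.orthonormal
  rintro (i | j) (i' | j')
  · simp only [Sum.elim_inl, Sum.inl.injEq]
    rw [← Submodule.coe_inner, h₁]
  · simp only [Sum.elim_inl, Sum.elim_inr, reduceCtorEq, if_false]
    exact Submodule.inner_right_of_mem_orthogonal (b₁ i).2 (b₂ j').2
  · simp only [Sum.elim_inl, Sum.elim_inr, reduceCtorEq, if_false]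
    exact Submodule.inner_left_of_mem_orthogonal (b₁ i').2 (b₂ j).2
  · simp only [Sum.elim_inr, Sum.inr.injEq]
    rw [← Submodule.coe_inner, h₂]

variable [FiniteDimensional 𝕜 V]

/-- In an orthonormal basis `b₁` of `K`, `∑ᵢ ⟪b₁ i, v⟫ b₁ i = P_K v` for every `v ∈ V`
(Mathlib's `OrthonormalBasis.orthogonalProjectionOnto_apply_eq_sum`, coerced to `V`; declared in
the `Submodule` namespace for dot notation). [folklore] -/
theorem _root_.Submodule.sum_inner_smul_eq_starProjection (K : Submodule 𝕜 V)
    (b₁ : OrthonormalBasis ι₁ 𝕜 K) (v : V) :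
    ∑ i, ⟪(b₁ i : V), v⟫_𝕜 • (b₁ i : V) = K.starProjection v := by
  rw [Submodule.starProjection_apply, b₁.orthogonalProjectionOnto_apply_eq_sum v,
    Submodule.coe_sum]
  rfl

/-- Dually, in an orthonormal basis `b₂` of `Kᗮ`, `∑ⱼ ⟪b₂ j, v⟫ b₂ j = v - P_K v` is the residual
of the projection onto `K` (declared in the `Submodule` namespace for dot notation). [folklore] -/
theorem _root_.Submodule.sum_inner_smul_eq_sub_starProjection (K : Submodule 𝕜 V)
    (b₂ : OrthonormalBasis ι₂ 𝕜 Kᗮ) (v : V) :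
    ∑ j, ⟪(b₂ j : V), v⟫_𝕜 • (b₂ j : V) = v - K.starProjection v := by
  rw [Kᗮ.sum_inner_smul_eq_starProjection b₂ v, eq_sub_iff_add_eq, add_comm,
    Submodule.starProjection_add_starProjection_orthogonal]

/-- **Orthonormal basis adapted to `V = K ⊕ Kᗮ`**: orthonormal bases of `K` (indexed by `ι₁`) and
of `Kᗮ` (indexed by `ι₂`) juxtapose to an orthonormal basis of `V` indexed by `ι₁ ⊕ ι₂` (a
`Sum`-indexed variant of `DirectSum.IsInternal.collectedOrthonormalBasis`; declared in Mathlib's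
`Submodule` namespace for dot notation). [folklore] -/
def _root_.Submodule.sumOrthonormalBasis (K : Submodule 𝕜 V) (b₁ : OrthonormalBasis ι₁ 𝕜 K)
    (b₂ : OrthonormalBasis ι₂ 𝕜 Kᗮ) : OrthonormalBasis (ι₁ ⊕ ι₂) 𝕜 V :=
  OrthonormalBasis.mk (K.orthonormal_sum_elim b₁ b₂) (by
    intro v _
    rw [← Submodule.starProjection_add_starProjection_orthogonal (K := K) v,
      ← K.sum_inner_smul_eq_starProjection b₁ v, ← Kᗮ.sum_inner_smul_eq_starProjection b₂ v]
    refine Submodule.add_mem _ ?_ ?_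
    · exact Submodule.sum_mem _ fun i _ => Submodule.smul_mem _ _
        (Submodule.subset_span ⟨Sum.inl i, rfl⟩)
    · exact Submodule.sum_mem _ fun j _ => Submodule.smul_mem _ _
        (Submodule.subset_span ⟨Sum.inr j, rfl⟩))

/-- The `inl`-vectors of the adapted basis are those of `b₁` (`Submodule` namespace, dot
notation). [folklore] -/
@[simp] theorem _root_.Submodule.sumOrthonormalBasis_apply_inl (K : Submodule 𝕜 V)
    (b₁ : OrthonormalBasis ι₁ 𝕜 K) (b₂ : OrthonormalBasis ι₂ 𝕜 Kᗮ) (i : ι₁) :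
    K.sumOrthonormalBasis b₁ b₂ (Sum.inl i) = b₁ i := by
  simp [Submodule.sumOrthonormalBasis]

/-- The `inr`-vectors of the adapted basis are those of `b₂` (`Submodule` namespace, dot
notation). [folklore] -/
@[simp] theorem _root_.Submodule.sumOrthonormalBasis_apply_inr (K : Submodule 𝕜 V)
    (b₁ : OrthonormalBasis ι₁ 𝕜 K) (b₂ : OrthonormalBasis ι₂ 𝕜 Kᗮ) (j : ι₂) :
    K.sumOrthonormalBasis b₁ b₂ (Sum.inr j) = b₂ j := by
  simp [Submodule.sumOrthonormalBasis]

end SumBasis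

/-! ### Proper subspaces are null -/

section Null

variable {V : Type*} [NormedAddCommGroup V] [InnerProductSpace ℂ V] [InnerProductSpace ℝ V]
  [IsScalarTower ℝ ℂ V] [FiniteDimensional ℝ V] [MeasurableSpace V] [BorelSpace V]

/-- **Proper complex subspaces are Gaussian-null** (a Gaussian vector avoids any given proper
subspace almost surely): the real case `stdGaussian_apply_submodule_eq_zero` applied to the
underlying real subspace. [folklore] -/
theorem stdGaussian_apply_complexSubmodule_eq_zero (K : Submodule ℂ V) (hK : K ≠ ⊤) :
    stdGaussian V K = 0 := by
  have h := stdGaussian_apply_submodule_eq_zero (K.restrictScalars ℝ)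
    (fun h => hK ((Submodule.restrictScalars_eq_top_iff ℝ ℂ V).1 h))
  simpa using h

end Null

end Literature.Probability.Distributions
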